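import Summits.AtomisticToContinuum.FouriersLaw.Theorems.JunctionLocalityDefs
import Summits.AtomisticToContinuum.FouriersLaw.Theorems.BondHeatUncertaintyLightConeBondHeatBondCorrelation

/-!
# Stub `stub_profileIntegrable` (PI) of line `contact-current-forgetting` — crux `JunctionLocality.NonBallistic`
(stmt-AtomisticToContinuum-9127)

STATUS (worker, 2026-08-16): complete — the registered stub `stub_profileIntegrable` is proved below, sorry-free,
from tree facts only (no neighbour stub is used).

Fixed-`N` integrability on `(0,∞)` of the contraction profile of the two contact currents,
`φ_N(s) = ∫ (κ_s j_0)² + (κ_s j_{N-2})² dμ_T` (`contactProfile`, route Defs file `JunctionLocalityDefs`), for the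
pinned anharmonic chain `pinnedChain ω₂ lam β γ` (all parameters `> 0`), `T > 0`, `N ≥ 2`; `κ_s` are the constructed
equal-temperature transition kernels `transitionKernel N T T s⁺` and `μ_T = gibbsMeasure N T`.

Proof. For a continuous observable `f` of exponential class `|f| ≤ C e^{ϑH}` (`0 < ϑ`, `2ϑ < 1/T`) with
`μ_T(f) = 0`, exponential convergence to the Gibbs measure (`pinnedChain_exp_convergence_gibbs`, CEHR (2.5) at equal
temperatures — proved in tree without any uniqueness hypothesis in the statement) gives
`|κ_u f(z)| ≤ M C₀ e^{ϑH(z)} e^{-cu}`, hence `∫ (κ_u f)² dμ_T ≤ (M C₀)² (∫ e^{2ϑH} dμ_T) e^{-2cu}`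
(`pinnedChain_sqAct_exp_decay`); `u ↦ ∫ (κ_{u⁺} f)² dμ_T` is measurable by the joint measurability of the kernels in
`(t, z)` (`pinnedChain_measurable_sqAct`); so it is integrable on `(0,∞)` (`pinnedChain_sqAct_integrableOn`). The bond
currents are of exponential class for every `ϑ > 0` (`pinnedChain_abs_bondCurrent_le_exp`) and have Gibbs mean zero by
momentum parity (`pinnedChain_integral_bondCurrent_gibbsMeasure`), and `φ_N` is the sum of the two squared
`L²(μ_T)`-norms (each finite: `pinnedChain_integral_sq_act_le`).
-/

noncomputable section

open MeasureTheory Set Filter Topology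
open scoped NNReal ENNReal
open Literature.MathematicalPhysics.KineticTheory.HeatConduction
open Summit.AtomisticToContinuum.FouriersLaw.Theorems.JunctionLocality

namespace Summit.AtomisticToContinuum.FouriersLaw.Theorems.NonBallistic

open ProbabilityTheory
open Literature.MathematicalPhysics.KineticTheory Literature.Probability.Process OscillatorChain
open Summit.AtomisticToContinuum.FouriersLaw.Theorems.SubdiffusiveBondHeat
open Summit.AtomisticToContinuum.FouriersLaw.Theorems.LightConeBondHeat

section Generic

variable {ω₂ lam β γ : ℝ} (hω : 0 < ω₂) (hl : 0 ≤ lam) (hβ : 0 < β) (hγ : 0 < γ) {N : ℕ} (hN : 0 < N)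
  {T : ℝ} (hT : 0 < T) {ϑ C : ℝ} (hϑ0 : 0 < ϑ) (h2ϑ : 2 * ϑ < 1 / T) {f : PhaseSpace N → ℝ}
  (hf : Continuous f) (hfb : ∀ y, |f y| ≤ C * Real.exp (ϑ * (pinnedChain ω₂ lam β γ).hamiltonian N y))
include hω hl hβ hγ hN hT hϑ0 h2ϑ hf hfb

omit hβ hγ hN hϑ0 h2ϑ hfb in
/-- `u ↦ ∫ (κ_{u⁺} f)² dμ_T` is a measurable function of time, for continuous `f` (joint measurability of the
transition kernels in `(t, z)`; adapted from `pinnedChain_measurable_autocorr`). [folklore] -/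
theorem pinnedChain_measurable_sqAct (hβ : 0 ≤ β) (hγ : 0 ≤ γ) :
    Measurable fun u : ℝ => ∫ z,
        (∫ y, f y ∂((pinnedChain ω₂ lam β γ).transitionKernel N T T u.toNNReal z)) ^ 2
      ∂((pinnedChain ω₂ lam β γ).gibbsMeasure N T) := by
  set P := pinnedChain ω₂ lam β γ with hP
  set μ := P.gibbsMeasure N T with hμ
  haveI : IsProbabilityMeasure μ := pinnedChain_isProbabilityMeasure_gibbsMeasure hω hl hβ γ N hT
  -- the kernels as ONE kernel on `ℝ≥0 × Ω`
  let κ₂ : Kernel (ℝ≥0 × PhaseSpace N) (PhaseSpace N) :=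
    { toFun := fun p => P.transitionKernel N T T p.1 p.2
      measurable' := pinnedChain_measurable_transitionKernel hω hl hβ hγ N T T }
  have hG : StronglyMeasurable fun p : ℝ≥0 × PhaseSpace N => ∫ y, f y ∂(κ₂ p) :=
    hf.stronglyMeasurable.integral_kernel (κ := κ₂)
  have h2 : StronglyMeasurable fun q : ℝ × PhaseSpace N => ∫ y, f y ∂(κ₂ (q.1.toNNReal, q.2)) :=
    hG.comp_measurable ((measurable_real_toNNReal.comp measurable_fst).prodMk measurable_snd)
  have hF : StronglyMeasurable fun q : ℝ × PhaseSpace N =>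
      (∫ y, f y ∂(P.transitionKernel N T T q.1.toNNReal q.2)) ^ 2 := h2.pow 2
  exact (hF.integral_prod_right' (ν := μ)).measurable

/-- **Exponential decay of `‖κ_u f‖²_{L²(μ_T)}` at fixed `N`**: if `∫ f dμ_T = 0` then
`∫ (κ_{u⁺} f)² dμ_T ≤ A e^{−c u}` for all `u ≥ 0` with `c > 0` — exponential convergence of `κ_u f(z)` to
`μ_T(f) = 0` with weight `e^{ϑH(z)}` (CEHR (2.5) at equal temperatures), squared and integrated against
`e^{2ϑH} ∈ L¹(μ_T)` (`2ϑ < 1/T`).  The rate depends on `N`.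
[cite: CuneoEckmannHairerReyBellet2018, Thm 2.13 (3)] -/
theorem pinnedChain_sqAct_exp_decay
    (h0 : ∫ z, f z ∂((pinnedChain ω₂ lam β γ).gibbsMeasure N T) = 0) :
    ∃ A c : ℝ, 0 < c ∧ ∀ u : ℝ, 0 ≤ u →
      ∫ z, (∫ y, f y ∂((pinnedChain ω₂ lam β γ).transitionKernel N T T u.toNNReal z)) ^ 2
        ∂((pinnedChain ω₂ lam β γ).gibbsMeasure N T) ≤ A * Real.exp (-c * u) := by
  set P := pinnedChain ω₂ lam β γ with hP
  set μ := P.gibbsMeasure N T with hμ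
  have hϑ1 : ϑ < 1 / T := by linarith
  obtain ⟨C₀, c, hC₀, hc, hconv⟩ := pinnedChain_exp_convergence_gibbs hω hl hβ hγ hN hT hϑ0 hϑ1
  set M : ℝ := |C| + 1 with hM
  have hM0 : 0 < M := by positivity
  have hfM : ∀ y, |f y| ≤ M * Real.exp (ϑ * P.hamiltonian N y) := fun y =>
    (hfb y).trans (mul_le_mul_of_nonneg_right (by rw [hM]; linarith [le_abs_self C]) (Real.exp_pos _).le)
  -- the weight `e^{2ϑH}` is `μ_T`-integrable
  have hwint : Integrable (fun z => Real.exp (2 * ϑ * P.hamiltonian N z)) μ :=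
    pinnedChain_integrable_exp_mul_hamiltonian_gibbsMeasure hω hl hβ.le γ N hT h2ϑ
  set W : ℝ := ∫ z, Real.exp (2 * ϑ * P.hamiltonian N z) ∂μ with hW
  refine ⟨(M * C₀) ^ 2 * W, 2 * c, by positivity, fun u hu => ?_⟩
  -- pointwise decay of `κ_u f`
  have hpt : ∀ z, |∫ y, f y ∂(P.transitionKernel N T T u.toNNReal z)| ≤
      M * C₀ * Real.exp (ϑ * P.hamiltonian N z) * Real.exp (-c * u) := by
    intro z
    have hf' : Continuous fun y => M⁻¹ * f y := continuous_const.mul hf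
    have hfb' : ∀ y, |M⁻¹ * f y| ≤ Real.exp (ϑ * P.hamiltonian N y) := fun y => by
      rw [abs_mul, abs_of_pos (inv_pos.2 hM0), inv_mul_le_iff₀ hM0]
      exact hfM y
    have h := hconv z u.toNNReal _ hf' hfb'
    rw [integral_const_mul, integral_const_mul, h0, mul_zero, sub_zero, abs_mul,
      abs_of_pos (inv_pos.2 hM0), inv_mul_le_iff₀ hM0, Real.coe_toNNReal _ hu] at h
    calc |∫ y, f y ∂(P.transitionKernel N T T u.toNNReal z)|
        ≤ M * (C₀ * Real.exp (ϑ * P.hamiltonian N z) * Real.exp (-c * u)) := h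
      _ = M * C₀ * Real.exp (ϑ * P.hamiltonian N z) * Real.exp (-c * u) := by ring
  -- squared
  have hsq : ∀ z, (∫ y, f y ∂(P.transitionKernel N T T u.toNNReal z)) ^ 2 ≤
      (M * C₀) ^ 2 * Real.exp (-(2 * c) * u) * Real.exp (2 * ϑ * P.hamiltonian N z) := by
    intro z
    have h := pow_le_pow_left₀ (abs_nonneg _) (hpt z) 2
    rw [sq_abs] at h
    have e1 : Real.exp (ϑ * P.hamiltonian N z) ^ 2 = Real.exp (2 * ϑ * P.hamiltonian N z) := by
      rw [← Real.exp_nat_mul]; ring_nf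
    have e2 : Real.exp (-c * u) ^ 2 = Real.exp (-(2 * c) * u) := by
      rw [← Real.exp_nat_mul]; ring_nf
    calc _ ≤ (M * C₀ * Real.exp (ϑ * P.hamiltonian N z) * Real.exp (-c * u)) ^ 2 := h
      _ = (M * C₀) ^ 2 * Real.exp (-c * u) ^ 2 * Real.exp (ϑ * P.hamiltonian N z) ^ 2 := by ring
      _ = (M * C₀) ^ 2 * Real.exp (-(2 * c) * u) * Real.exp (2 * ϑ * P.hamiltonian N z) := by rw [e1, e2]
  -- integrate
  calc ∫ z, (∫ y, f y ∂(P.transitionKernel N T T u.toNNReal z)) ^ 2 ∂μ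
      ≤ ∫ z, (M * C₀) ^ 2 * Real.exp (-(2 * c) * u) * Real.exp (2 * ϑ * P.hamiltonian N z) ∂μ :=
        integral_mono_of_nonneg (Eventually.of_forall fun z => sq_nonneg _) (hwint.const_mul _)
          (Eventually.of_forall hsq)
    _ = (M * C₀) ^ 2 * W * Real.exp (-(2 * c) * u) := by rw [integral_const_mul]; ring

/-- **`u ↦ ‖κ_u f‖²_{L²(μ_T)}` is integrable on `(0,∞)`** at fixed `N`, for a continuous observable `f` of exponential
class `|f| ≤ C e^{ϑH}` (`0 < ϑ`, `2ϑ < 1/T`) with `μ_T(f) = 0`: measurable, nonnegative and dominated by an integrable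
exponential (`pinnedChain_sqAct_exp_decay`). [folklore] -/
theorem pinnedChain_sqAct_integrableOn
    (h0 : ∫ z, f z ∂((pinnedChain ω₂ lam β γ).gibbsMeasure N T) = 0) :
    IntegrableOn (fun u : ℝ => ∫ z,
        (∫ y, f y ∂((pinnedChain ω₂ lam β γ).transitionKernel N T T u.toNNReal z)) ^ 2
      ∂((pinnedChain ω₂ lam β γ).gibbsMeasure N T)) (Ioi 0) := by
  obtain ⟨A, c, hc, hb⟩ := pinnedChain_sqAct_exp_decay hω hl hβ hγ hN hT hϑ0 h2ϑ hf hfb h0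
  refine Integrable.mono' ((exp_neg_integrableOn_Ioi 0 hc).const_mul A)
    (pinnedChain_measurable_sqAct hω hl hT hf hβ.le hγ.le).aestronglyMeasurable ?_
  refine (ae_restrict_iff' measurableSet_Ioi).2 (Eventually.of_forall fun u hu => ?_)
  rw [Real.norm_eq_abs, abs_of_nonneg (integral_nonneg fun z => sq_nonneg _)]
  exact hb u (le_of_lt hu)

end Generic

/-- **STUB 7 (PI) — `stub_profileIntegrable`** (registered stub of line `contact-current-forgetting`, crux
stmt-AtomisticToContinuum-9127): for `ω₂, lam, β, γ > 0`, `T > 0` and every `N ≥ 2`, the contraction profile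
`φ_N(s) = ‖κ_s j_0‖²_{L²(μ_T)} + ‖κ_s j_{N−2}‖²_{L²(μ_T)}` of the two contact currents is integrable on `(0,∞)` — each
contact current is continuous, of exponential class `|j| ≤ K e^{H/(4T)}` and has Gibbs mean zero, so each squared norm
is integrable on `(0,∞)` by `pinnedChain_sqAct_integrableOn` (exponential convergence to `μ_T` at fixed `N`), and
`φ_N` is their sum. [folklore] -/
theorem stub_profileIntegrable :
    ∀ ω₂ lam β γ : ℝ, 0 < ω₂ → 0 < lam → 0 < β → 0 < γ → ∀ T : ℝ, 0 < T → ∀ N : ℕ, 2 ≤ N →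
      IntegrableOn (contactProfile (pinnedChain ω₂ lam β γ) N T) (Ioi 0) := by
  intro ω₂ lam β γ hω hlam hβ hγ T hT N hN
  have hN0 : 0 < N := by omega
  have h2 : N - 2 < N := by omega
  set P := pinnedChain ω₂ lam β γ with hP
  obtain ⟨hϑ0, h2ϑ⟩ := quarter_inv_temp_admissible hT
  -- each squared norm `u ↦ ‖κ_u j_i‖²` is integrable on `(0,∞)`
  have key : ∀ i : Fin N, IntegrableOn (fun u : ℝ => ∫ z,
      (∫ y, P.bondCurrent N i y ∂(P.transitionKernel N T T u.toNNReal z)) ^ 2 ∂(P.gibbsMeasure N T)) (Ioi 0) :=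
    fun i => pinnedChain_sqAct_integrableOn hω hlam.le hβ hγ hN0 hT hϑ0 h2ϑ
      (pinnedChain_continuous_bondCurrent ω₂ lam β γ N i)
      (pinnedChain_abs_bondCurrent_le_exp hω.le hlam.le hβ.le γ N hϑ0 i)
      (pinnedChain_integral_bondCurrent_gibbsMeasure ω₂ lam β γ N T i)
  -- each squared action is `μ_T`-integrable at every time
  have hsq : ∀ (i : Fin N) (u : ℝ), Integrable (fun z =>
      (∫ y, P.bondCurrent N i y ∂(P.transitionKernel N T T u.toNNReal z)) ^ 2) (P.gibbsMeasure N T) :=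
    fun i u => (pinnedChain_integral_sq_act_le hω hlam.le hβ hγ hN0 hT hϑ0 h2ϑ
      (pinnedChain_continuous_bondCurrent ω₂ lam β γ N i)
      (pinnedChain_abs_bondCurrent_le_exp hω.le hlam.le hβ.le γ N hϑ0 i) u.toNNReal).2.1
  -- the profile is the sum of the two squared norms
  have heq : contactProfile P N T = fun u =>
      (∫ z, (∫ y, P.bondCurrent N ⟨0, hN0⟩ y ∂(P.transitionKernel N T T u.toNNReal z)) ^ 2
        ∂(P.gibbsMeasure N T)) +
      ∫ z, (∫ y, P.bondCurrent N ⟨N - 2, h2⟩ y ∂(P.transitionKernel N T T u.toNNReal z)) ^ 2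
        ∂(P.gibbsMeasure N T) := by
    funext u
    have e0 : bondCurrentAt P N 0 = P.bondCurrent N ⟨0, hN0⟩ :=
      funext fun z => bondCurrentAt_eq_bondCurrent P hN0 z
    have e2 : bondCurrentAt P N (N - 2) = P.bondCurrent N ⟨N - 2, h2⟩ :=
      funext fun z => bondCurrentAt_eq_bondCurrent P h2 z
    rw [contactProfile_def]
    simp only [evolve_def, e0, e2]
    exact integral_add (hsq _ u) (hsq _ u)
  rw [heq]
  exact (key _).add (key _)

end Summit.AtomisticToContinuum.FouriersLaw.Theorems.NonBallistic

end
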